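import Summits.BirchSwinnertonDyer.Rank1Residual.GaloisImage.IrreducibleModThreeCentralInvolution
import Mathlib.LinearAlgebra.Matrix.GeneralLinearGroup.Card
import Mathlib.RingTheory.ZMod.UnitsCyclic
import HarnessLib

/-!
# `−1 ∈ ρ̄_{E,5}(Γ_ℚ)` for EVERY `E/ℚ` with `E[5]` irreducible — the `hneg` input of the (T4′) corner Čebotarev at
# `p = 5` (cell `bsd-stepL`, seat `bsd-stepL-corner-p1` g8; `--supports stmt-BirchSwinnertonDyer-19947`; of use to the
# small-image axis N3 = X9 at `p = 5` of cell `b2b-bsdres`, which the mod-`3` file leaves open)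

WHAT. The corner road to `stub_kolyJ_max` (Jetchev's max form at `p ∥ N` on the irreducible non-surjective cell) runs
McCallum's Cor. 3.2 on the irreducible cell through `…NonSurjCornerKolyJWalkCebotarev` (p501512) and the swap supply's
`exists_deep_of_swapFamilies_of_irr_of_neg'` (p512423), both keyed on `hneg : ∃ γ ∈ Γ_ℚ, γ = −1 on E[p]`. At `p = 3` this is
free (`exists_smul_eq_neg_three_of_irr`, file `IrreducibleModThreeCentralInvolution`: an irreducible subgroup of `GL₂(𝔽₃)`
of order prime to `3` is a `2`-group). At `p = 5` an irreducible subgroup of `GL₂(𝔽₅)` need NOT contain `−1` (the dihedral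
group of order `6` generated by an element of order `3` of `SL₂(𝔽₅)` and a reflection is irreducible), but a GALOIS image
does, because its determinant is ONTO `𝔽₅^×` (`det ρ̄ = χ̄₅`, Weil pairing — tree theorem
`exists_frame_galoisRepTorsion_rat`, clause (iv)):
* §1 `det_one_involution_eq` — in `GL₂(𝔽₅)` an involution of determinant `1` is `±1` (Cayley–Hamilton by hand).
* §2 **`exists_central_involution_of_det_onto`** (pure group theory) — a finite group `G` of order prime to `5` and
  dividing `480 = #GL₂(𝔽₅)`, with a homomorphism `D` ONTO `(ℤ/5)^×` whose kernel `H` contains no involution, has a CENTRAL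
  involution. Proof: `H` has odd order (Cauchy), `#G = 4·#H ∣ 480` and `5 ∤ #G` force `#H ∣ 3`; an `x` with `D x` a
  generator has `x^b` (`b` the odd part of `ord x`) of order exactly `4` (its fourth power lies in `H` and has `2`-power
  order); `z = (x^b)²` is an involution centralising `⟨x^b⟩` and — conjugation by `x^b` on the cyclic group `H` of order
  `≤ 3` squares to the identity — centralising `H`, and `G = H·⟨x^b⟩`.
* §3 **`exists_smul_eq_neg_five_of_irr_of_not_surj`**, **`exists_smul_eq_neg_five_of_irr`** — `E[5]` irreducible ⟹ some
  `z ∈ Γ_ℚ` acts as `−1` on `E[5]`: onto ⇒ n1011-p04's lemma; not onto ⇒ `5 ∤ #ρ̄(Γ_ℚ)` (Serre Prop. 15,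
  `not_dvd_card_map_galoisRepTorsion_of_irr_of_not_surj`), and either the kernel of `det` on the image has an involution —
  which is `−1` by §1 — or §2 gives a central involution, which is `−1` because the image has no stable line
  (`smul_eq_neg_of_not_exists_stableLine`).
HONEST FRAMING: theorems only (no definition, no named fact, no `sorry`); a statement about Galois images, nothing about
BSD; no stub closes; no census label moves (T7). NOT claimed: `p = 7` (there the scalar subgroup of the image may have
order `3` and `−1 ∉ ρ̄(Γ_ℚ)` does occur: Sutherland's `7Ns` images without `−I`).
References: [Serre1972] §2.4 Prop. 15, §2.6; [SilvermanCSS1997] Ch. II §7–§8 (det ρ̄ = χ); [MatarNekovar2019] Prop. 5.26 (2)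
(the rôle of `−1`); [Zywina2015] arXiv:1508.07660 §1 (the possible images at `5`). Axioms: `propext`, `Classical.choice`,
`Quot.sound`.
-/

set_option autoImplicit false

noncomputable section

open scoped Classical

open Field WeierstrassCurve
  Literature.NumberTheory.EllipticCurves Literature.NumberTheory.GaloisRepresentations
  Literature.NumberTheory.EllipticCurves.Rank1Residual

namespace Summit.BirchSwinnertonDyer.Rank1Residual.GaloisImage

/-! ## §1. Involutions of determinant one in `GL₂(𝔽₅)` -/

/-- In `M₂(𝔽₅)`: `M² = 1` and `det M = 1` force `M = ±1` (Cayley–Hamilton: `M² − tr(M)·M + det(M) = 0` gives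
`tr(M)·M = 2`, and `tr(M) = 0` would give `2 = 0`). [cite: Serre1972, §2.6 (involutions of GL₂(𝔽_p))] -/
theorem det_one_involution_eq (M : Matrix (Fin 2) (Fin 2) (ZMod 5)) (h2 : M * M = 1) (hdet : M.det = 1) :
    M = 1 ∨ M = -1 := by
  have hM := Matrix.eta_fin_two M
  set a := M 0 0; set b := M 0 1; set c := M 1 0; set d := M 1 1
  rw [hM, Matrix.det_fin_two_of] at hdet
  rw [hM, Matrix.mul_fin_two, Matrix.one_fin_two] at h2
  have h00 : a * a + b * c = 1 := by simpa using congrFun (congrFun h2 0) 0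
  have h01 : a * b + b * d = 0 := by simpa using congrFun (congrFun h2 0) 1
  have h10 : c * a + d * c = 0 := by simpa using congrFun (congrFun h2 1) 0
  have h11 : c * b + d * d = 1 := by simpa using congrFun (congrFun h2 1) 1
  -- finite check on the four entries
  have key : ∀ a b c d : ZMod 5, a * d - b * c = 1 → a * a + b * c = 1 → a * b + b * d = 0 →
      c * a + d * c = 0 → c * b + d * d = 1 → (a = 1 ∧ b = 0 ∧ c = 0 ∧ d = 1) ∨ (a = -1 ∧ b = 0 ∧ c = 0 ∧ d = -1) := by
    decide
  rcases key a b c d hdet h00 h01 h10 h11 with ⟨ha, hb, hc, hd⟩ | ⟨ha, hb, hc, hd⟩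
  · left; rw [hM, ha, hb, hc, hd, Matrix.one_fin_two]
  · right; rw [hM, ha, hb, hc, hd, Matrix.one_fin_two]; simp

/-! ## §2. Pure group theory: a central involution from a determinant onto `(ℤ/5)^×` -/

/-- **A central involution.** `G` finite, `5 ∤ #G`, `#G ∣ 480`, `D : G →* (ℤ/5)^×` onto, and no involution in
`ker D` ⟹ `G` has a central involution. (Used for `G = ρ̄_{E,5}(Γ_ℚ) ≤ GL₂(𝔽₅)`, `D = det`; see the module docstring
for the argument.) [cite: Serre1972, §2.6] -/
theorem exists_central_involution_of_det_onto {G : Type*} [Group G] [Finite G]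
    (D : G →* (ZMod 5)ˣ) (hD : Function.Surjective D) (h5 : ¬ 5 ∣ Nat.card G) (h480 : Nat.card G ∣ 480)
    (hH : ∀ h : G, D h = 1 → h * h = 1 → h = 1) :
    ∃ z : G, z ≠ 1 ∧ z * z = 1 ∧ ∀ g : G, z * g = g * z := by
  have hp5 : Nat.Prime 5 := by norm_num
  haveI : Fact (Nat.Prime 5) := ⟨hp5⟩
  haveI : Fact (Nat.Prime 2) := ⟨Nat.prime_two⟩
  haveI : Fact (Nat.Prime 3) := ⟨Nat.prime_three⟩
  -- `(ℤ/5)^×` is cyclic of order `4`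
  have hcardU : Nat.card (ZMod 5)ˣ = 4 := by
    rw [Nat.card_eq_fintype_card, ZMod.card_units]
  haveI : IsCyclic (ZMod 5)ˣ := ZMod.isCyclic_units_prime hp5
  obtain ⟨u₀, hu₀⟩ := IsCyclic.exists_generator (α := (ZMod 5)ˣ)
  have hordu₀ : orderOf u₀ = 4 := by rw [orderOf_eq_card_of_forall_mem_zpowers hu₀, hcardU]
  -- elements of the kernel have odd order
  have hker_odd : ∀ k : G, D k = 1 → Odd (orderOf k) := by
    intro k hk
    by_contra hodd
    rw [Nat.not_odd_iff_even] at hodd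
    obtain ⟨j, hj⟩ := hodd
    set w := k ^ j with hw
    have hj0 : 0 < j := by
      rcases Nat.eq_zero_or_pos j with h | h
      · rw [h] at hj; exact absurd hj (orderOf_pos k).ne'
      · exact h
    have hw2 : w * w = 1 := by rw [hw, ← pow_add, ← hj]; exact pow_orderOf_eq_one k
    have hw1 : w ≠ 1 := by
      intro h
      have : orderOf k ∣ j := orderOf_dvd_of_pow_eq_one (hw ▸ h)
      have := Nat.le_of_dvd hj0 this
      omega
    exact hw1 (hH w (by rw [hw, map_pow, hk, one_pow]) hw2)
  -- an `x` with `D x = u₀`; its odd part `b`, `y = x^b` of `2`-power order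
  obtain ⟨x, hx⟩ := hD u₀
  have hm0 : orderOf x ≠ 0 := (orderOf_pos x).ne'
  obtain ⟨a, b, hb, hm⟩ := Nat.exists_eq_two_pow_mul_odd hm0
  have hb0 : b ≠ 0 := by rintro rfl; exact absurd hb (by decide)
  set y := x ^ b with hy
  have hordy : orderOf y = 2 ^ a := by
    rw [hy, orderOf_pow' x hb0, hm, Nat.gcd_mul_left_left, Nat.mul_div_cancel _ (Nat.pos_of_ne_zero hb0)]
  have hcop4b : Nat.Coprime 4 b := by
    have : Nat.Coprime 2 b := Nat.coprime_two_left.mpr hb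
    simpa using this.pow_left 2
  have hordDy : orderOf (D y) = 4 := by
    rw [hy, map_pow, hx, orderOf_pow' u₀ hb0, hordu₀, hcop4b.gcd_eq_one, Nat.div_one]
  -- `y⁴ = 1`: it lies in the kernel and has `2`-power order
  have hy4 : y ^ 4 = 1 := by
    have hk : D (y ^ 4) = 1 := by rw [map_pow, ← hordDy, pow_orderOf_eq_one]
    have hodd := hker_odd _ hk
    have hdvd : orderOf (y ^ 4) ∣ 2 ^ a := by rw [← hordy]; exact orderOf_pow_dvd 4
    have h1 : orderOf (y ^ 4) = 1 :=
      Nat.Coprime.eq_one_of_dvd ((Nat.coprime_two_right.mpr hodd).pow_right a) hdvd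
    exact orderOf_eq_one_iff.mp h1
  -- `ord y = 4`; the involution `z = y²`
  have hordy4 : orderOf y = 4 := by
    apply Nat.dvd_antisymm (orderOf_dvd_of_pow_eq_one hy4)
    rw [← hordDy]; exact orderOf_map_dvd D y
  set z := y ^ 2 with hz
  have hz1 : z ≠ 1 := by
    intro h
    have h2 : orderOf y ∣ 2 := orderOf_dvd_of_pow_eq_one (by rw [← hz]; exact h)
    rw [hordy4] at h2
    exact absurd (Nat.le_of_dvd (by norm_num) h2) (by norm_num)
  have hz2 : z * z = 1 := by
    rw [hz, ← pow_add]; exact hy4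
  -- the kernel `H`: index `4`, odd order, order dividing `3`
  set H := D.ker with hHdef
  have hidx : H.index = 4 := by
    rw [hHdef, Subgroup.index_ker, MonoidHom.range_eq_top.mpr hD, Subgroup.card_top, hcardU]
  have hcardG : Nat.card H * 4 = Nat.card G := by rw [← hidx]; exact Subgroup.card_mul_index H
  have hH5 : ¬ 5 ∣ Nat.card H := fun h ↦ h5 (hcardG ▸ Dvd.dvd.mul_right h 4)
  have hHodd : Odd (Nat.card H) := by
    by_contra heven
    rw [Nat.not_odd_iff_even] at heven
    obtain ⟨k, hk⟩ := exists_prime_orderOf_dvd_card' (G := H) 2 (even_iff_two_dvd.mp heven)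
    have hk1 : D (k : G) = 1 := k.2
    have hodd := hker_odd (k : G) hk1
    rw [Subgroup.orderOf_coe, hk] at hodd
    exact absurd hodd (by decide)
  have hH3 : Nat.card H ∣ 3 := by
    have h120 : Nat.card H ∣ 120 := by
      have : Nat.card H * 4 ∣ 120 * 4 := by rw [hcardG]; simpa using h480
      exact Nat.dvd_of_mul_dvd_mul_right (by norm_num) this
    have h15 : Nat.card H ∣ 15 := by
      have hc8 : Nat.Coprime (Nat.card H) 8 := by
        simpa using (Nat.coprime_two_right.mpr hHodd).pow_right 3
      exact hc8.dvd_of_dvd_mul_left (show Nat.card H ∣ 8 * 15 by simpa using h120)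
    have hc5 : Nat.Coprime (Nat.card H) 5 :=
      Nat.coprime_comm.mp ((Nat.Prime.coprime_iff_not_dvd hp5).mpr hH5)
    exact hc5.dvd_of_dvd_mul_right (show Nat.card H ∣ 3 * 5 by simpa using h15)
  -- conjugation by `y` on `H` is `h ↦ h` or `h ↦ h⁻¹`
  have hconjH : ∀ h : G, D h = 1 → y * h * y⁻¹ = h ∨ y * h * y⁻¹ = h⁻¹ := by
    intro h hh
    by_cases h1 : h = 1
    · left; rw [h1, mul_one, mul_inv_cancel]
    · have hcard3 : Nat.card H = 3 := by
        rcases (Nat.dvd_prime Nat.prime_three).mp hH3 with hc | hc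
        · exfalso
          haveI : Subsingleton H := (Nat.card_eq_one_iff_unique.mp hc).1
          have : (⟨h, hh⟩ : H) = ⟨1, H.one_mem⟩ := Subsingleton.elim _ _
          exact h1 (congrArg Subtype.val this)
        · exact hc
      have hconj_mem : y * h * y⁻¹ ∈ H := by
        show D (y * h * y⁻¹) = 1
        rw [map_mul, map_mul, hh, mul_one, map_inv, mul_inv_cancel]
      have hne : (⟨h, hh⟩ : H) ≠ 1 := fun h0 ↦ h1 (congrArg Subtype.val h0)
      have hmem : (⟨y * h * y⁻¹, hconj_mem⟩ : H) ∈ Submonoid.powers (⟨h, hh⟩ : H) :=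
        mem_powers_of_prime_card hcard3 hne
      obtain ⟨n, hn⟩ := hmem
      have hn' : h ^ n = y * h * y⁻¹ := by
        have := congrArg Subtype.val hn
        simpa using this
      have hh3 : h ^ 3 = 1 := by
        have : (⟨h, hh⟩ : H) ^ Nat.card H = 1 := pow_card_eq_one'
        rw [hcard3] at this
        simpa using congrArg Subtype.val this
      have hmod : h ^ n = h ^ (n % 3) := by
        conv_lhs => rw [← Nat.mod_add_div n 3, pow_add, pow_mul, hh3, one_pow, mul_one]
      have hlt : n % 3 < 3 := Nat.mod_lt n (by norm_num)
      rw [hmod] at hn'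
      interval_cases (n % 3)
      · -- `y h y⁻¹ = 1`: then `h = 1`
        exfalso; apply h1
        rw [pow_zero] at hn'
        have : h = y⁻¹ * 1 * y := by
          rw [hn']; group
        rw [this]; group
      · left; rw [pow_one] at hn'; exact hn'.symm
      · right
        rw [← hn']
        -- `h² = h⁻¹` since `h³ = 1`
        rw [eq_inv_iff_mul_eq_one, ← pow_succ, hh3]
  -- hence `z = y²` centralises `H`
  have hzH : ∀ h : G, D h = 1 → z * h = h * z := by
    intro h hh
    have key : z * h * z⁻¹ = h := by
      rcases hconjH h hh with hc | hc
      · calc z * h * z⁻¹ = y * (y * h * y⁻¹) * y⁻¹ := by rw [hz, pow_two]; group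
          _ = h := by rw [hc, hc]
      · have hinvmem : D h⁻¹ = 1 := by rw [map_inv, hh, inv_one]
        have hc' : y * h⁻¹ * y⁻¹ = h := by
          rcases hconjH h⁻¹ hinvmem with h' | h'
          · -- then also `y h y⁻¹ = h`, so `h⁻¹ = h`, fine either way
            have : y * h * y⁻¹ = h := by
              have := congrArg (·⁻¹) h'
              simpa [mul_inv_rev, mul_assoc] using this
            rw [this] at hc
            -- `h = h⁻¹`
            rw [h', ← hc]
          · simpa using h'
        calc z * h * z⁻¹ = y * (y * h * y⁻¹) * y⁻¹ := by rw [hz, pow_two]; group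
          _ = h := by rw [hc, hc']
    calc z * h = z * h * z⁻¹ * z := by group
      _ = h * z := by rw [key]
  -- `G = H · ⟨y⟩`
  have hdecomp : ∀ g : G, ∃ (i : ℕ) (h : G), D h = 1 ∧ g = h * y ^ i := by
    intro g
    have hgen : D g ∈ Subgroup.zpowers (D y) := by
      have htop : Subgroup.zpowers (D y) = ⊤ := by
        apply Subgroup.eq_top_of_card_eq
        rw [Nat.card_zpowers, hordDy, hcardU]
      rw [htop]; exact Subgroup.mem_top _
    rw [← mem_powers_iff_mem_zpowers] at hgen
    obtain ⟨i, hi⟩ := hgen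
    refine ⟨i, g * (y ^ i)⁻¹, ?_, by group⟩
    rw [map_mul, map_inv, map_pow, ← hi, mul_inv_cancel]
  refine ⟨z, hz1, hz2, fun g ↦ ?_⟩
  obtain ⟨i, h, hh, rfl⟩ := hdecomp g
  have hzy : z * y ^ i = y ^ i * z := by rw [hz, ← pow_add, ← pow_add, add_comm]
  calc z * (h * y ^ i) = (z * h) * y ^ i := by rw [mul_assoc]
    _ = (h * z) * y ^ i := by rw [hzH h hh]
    _ = h * (y ^ i * z) := by rw [mul_assoc, hzy]
    _ = h * y ^ i * z := by rw [mul_assoc]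



/-! ## §3. `E[5]` irreducible ⟹ `−1 ∈ ρ̄_{E,5}(Γ_ℚ)` -/

section Five

variable (W : WeierstrassCurve ℚ) [W.IsElliptic]

/-- **`E[5]` irreducible, `ρ̄_{E,5}` not onto ⟹ some `z ∈ Γ_ℚ` acts as `−1` on `E[5]`.** The image
`G = ρ̄_{E,5}(Γ_ℚ) ≤ GL₂(𝔽₅)` has order prime to `5` (Serre Prop. 15) and determinant ONTO `𝔽₅^×` (`det ρ̄ = χ̄₅`, Weil
pairing); an involution of determinant one in `G` is `−1` (§1); otherwise §2 gives a central involution of `G`, which is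
`−1` because `G` stabilises no line. [cite: Serre1972, §2.4 Prop. 15 and §2.6] [cite: SilvermanCSS1997, Ch. II §7 Proposition] -/
theorem exists_smul_eq_neg_five_of_irr_of_not_surj (hirr : Irr W 5) (hns : ¬ Surj W 5) :
    ∃ z : absoluteGaloisGroup ℚ, ∀ P : geomTorsion W ((5 : ℕ) : ℤ), z • P = -P := by
  haveI : Fact (Nat.Prime 5) := ⟨by norm_num⟩
  set ρ := galoisRepTorsion W ((5 : ℕ) : ℤ) with hρ
  -- no `Γ_ℚ`-stable line (irreducibility; `#E[5] = 25`)
  have hE : Nat.card (geomTorsion W ((5 : ℕ) : ℤ)) = 5 ^ 2 :=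
    Literature.NumberTheory.EllipticCurves.natCard_geomTorsion W 5
  haveI : Finite (geomTorsion W ((5 : ℕ) : ℤ)) :=
    Nat.finite_of_card_ne_zero (by rw [hE]; decide)
  have hno : ¬ ∃ L : AddSubgroup (geomTorsion W ((5 : ℕ) : ℤ)), Nat.card L = 5 ∧
      ∀ σ ∈ (⊤ : Subgroup (absoluteGaloisGroup ℚ)), ∀ P ∈ L, σ • P ∈ L := by
    rintro ⟨L, hL, hstab⟩
    rcases hirr L (fun σ P hP ↦ hstab σ (Subgroup.mem_top σ) P hP) with h | h
    · rw [h, AddSubgroup.card_bot] at hL; exact absurd hL (by decide)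
    · rw [h, AddSubgroup.card_top, hE] at hL; exact absurd hL (by decide)
  -- the image `G`, finite, of order prime to `5`
  set G : Subgroup (Multiplicative (AddAut (geomTorsion W ((5 : ℕ) : ℤ)))) := ρ.range with hG
  haveI : Finite (AddAut (geomTorsion W ((5 : ℕ) : ℤ))) :=
    Finite.of_injective (fun e : AddAut (geomTorsion W ((5 : ℕ) : ℤ)) ↦
      (e : geomTorsion W ((5 : ℕ) : ℤ) → geomTorsion W ((5 : ℕ) : ℤ))) DFunLike.coe_injective
  haveI : Finite (Multiplicative (AddAut (geomTorsion W ((5 : ℕ) : ℤ)))) :=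
    inferInstanceAs (Finite (AddAut (geomTorsion W ((5 : ℕ) : ℤ))))
  have h5 : ¬ 5 ∣ Nat.card G := by
    rw [hG, MonoidHom.range_eq_map]
    exact not_dvd_card_map_galoisRepTorsion_of_irr_of_not_surj W 5 hirr hns ⊤
  -- the frame: coordinates and `det` onto `𝔽₅^×`
  obtain ⟨e, Φ, he, -, -, hdetsurj, -⟩ := exists_frame_galoisRepTorsion_rat W 5
  let D : G →* (ZMod 5)ˣ := Matrix.GeneralLinearGroup.det.comp (Φ.toMonoidHom.comp G.subtype)
  have hDapply : ∀ g : G, D g = Matrix.GeneralLinearGroup.det (Φ (g : Multiplicative (AddAut _))) :=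
    fun g ↦ rfl
  have hD : Function.Surjective D := by
    intro u
    obtain ⟨σ, hσ⟩ := hdetsurj u
    exact ⟨⟨ρ σ, σ, rfl⟩, by rw [hDapply]; exact hσ⟩
  have h480 : Nat.card G ∣ 480 := by
    have h1 : Nat.card G ∣ Nat.card (Multiplicative (AddAut (geomTorsion W ((5 : ℕ) : ℤ)))) :=
      Subgroup.card_subgroup_dvd_card G
    have h2 : Nat.card (Multiplicative (AddAut (geomTorsion W ((5 : ℕ) : ℤ)))) =
        Nat.card (GL (Fin 2) (ZMod 5)) := Nat.card_congr Φ.toEquiv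
    have h3 : Nat.card (GL (Fin 2) (ZMod 5)) = 480 := by
      rw [Matrix.card_GL_field, ZMod.card, Fin.prod_univ_two]
      norm_num
    rwa [h2, h3] at h1
  -- an element of `G` whose matrix is `−1` comes from a `z ∈ Γ_ℚ` acting as `−1`
  have hneg_of : ∀ g : G,
      ((Φ (g : Multiplicative (AddAut (geomTorsion W ((5 : ℕ) : ℤ)))) : GL (Fin 2) (ZMod 5)) :
        Matrix (Fin 2) (Fin 2) (ZMod 5)) = -1 →
      ∃ z : absoluteGaloisGroup ℚ, ∀ P : geomTorsion W ((5 : ℕ) : ℤ), z • P = -P := by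
    intro g hg
    obtain ⟨σ, hσ⟩ := g.2
    refine ⟨σ, fun P ↦ ?_⟩
    have h1 := he (g : Multiplicative (AddAut (geomTorsion W ((5 : ℕ) : ℤ)))) P
    rw [hg, Matrix.neg_mulVec, Matrix.one_mulVec, ← map_neg] at h1
    have h2 := e.injective h1
    rw [← hσ] at h2
    simpa [hρ, galoisRepTorsion_apply] using h2
  by_cases hinv : ∃ h : G, D h = 1 ∧ h ≠ 1 ∧ h * h = 1
  · -- an involution of determinant one in `G`: it is `−1`
    obtain ⟨h, hD1, hne1, hh2⟩ := hinv
    apply hneg_of h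
    set M : Matrix (Fin 2) (Fin 2) (ZMod 5) :=
      ((Φ (h : Multiplicative (AddAut (geomTorsion W ((5 : ℕ) : ℤ)))) : GL (Fin 2) (ZMod 5)) :
        Matrix (Fin 2) (Fin 2) (ZMod 5)) with hM
    have hΦ2 : Φ (h : Multiplicative (AddAut (geomTorsion W ((5 : ℕ) : ℤ)))) *
        Φ (h : Multiplicative (AddAut (geomTorsion W ((5 : ℕ) : ℤ)))) = 1 := by
      rw [← map_mul, ← Subgroup.coe_mul, hh2, Subgroup.coe_one, map_one]
    have hM2 : M * M = 1 := by
      have := congrArg (fun u : GL (Fin 2) (ZMod 5) ↦ (u : Matrix (Fin 2) (Fin 2) (ZMod 5))) hΦ2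
      simpa [Units.val_mul] using this
    have hMdet : M.det = 1 := by
      have h1 : ((D h : (ZMod 5)ˣ) : ZMod 5) = 1 := by rw [hD1, Units.val_one]
      rw [hDapply, Matrix.GeneralLinearGroup.val_det_apply] at h1
      exact h1
    rcases det_one_involution_eq M hM2 hMdet with h1 | h1
    · exfalso
      apply hne1
      have hΦ1 : Φ (h : Multiplicative (AddAut (geomTorsion W ((5 : ℕ) : ℤ)))) = 1 := Units.ext h1
      have : (h : Multiplicative (AddAut (geomTorsion W ((5 : ℕ) : ℤ)))) = 1 :=
        Φ.injective (hΦ1.trans (map_one Φ).symm)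
      exact Subtype.ext this
    · exact h1
  · -- no involution in the kernel: §2 gives a central involution of `G`, which is `−1`
    push Not at hinv
    have hH : ∀ h : G, D h = 1 → h * h = 1 → h = 1 := fun h h1 h2 ↦ by
      by_contra hne
      exact hinv h h1 hne h2
    obtain ⟨g₀, hg₀1, hg₀2, hg₀c⟩ := exists_central_involution_of_det_onto D hD h5 h480 hH
    obtain ⟨z, hz⟩ : ∃ z : absoluteGaloisGroup ℚ,
        ρ z = (g₀ : Multiplicative (AddAut (geomTorsion W ((5 : ℕ) : ℤ)))) := g₀.2
    have hz2 : ∀ P : geomTorsion W ((5 : ℕ) : ℤ), z • z • P = P := by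
      have h1 : ρ (z * z) = 1 := by rw [map_mul, hz, ← Subgroup.coe_mul, hg₀2, Subgroup.coe_one]
      intro P
      rw [← mul_smul]
      exact (galoisRepTorsion_eq_one_iff' W ((5 : ℕ) : ℤ) _).mp h1 P
    have hz1 : ∃ P : geomTorsion W ((5 : ℕ) : ℤ), z • P ≠ P := by
      by_contra h
      push Not at h
      have h1 : ρ z = 1 := (galoisRepTorsion_eq_one_iff' W ((5 : ℕ) : ℤ) z).mpr h
      apply hg₀1
      exact Subtype.ext (by rw [← hz, h1, Subgroup.coe_one])
    have hcomm : ∀ σ ∈ (⊤ : Subgroup (absoluteGaloisGroup ℚ)), ∀ P : geomTorsion W ((5 : ℕ) : ℤ),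
        z • σ • P = σ • z • P := by
      intro σ _ P
      have hσG : ρ σ ∈ G := ⟨σ, rfl⟩
      have hcen : g₀ * ⟨ρ σ, hσG⟩ = ⟨ρ σ, hσG⟩ * g₀ := hg₀c ⟨ρ σ, hσG⟩
      have hc' : ρ (z * σ) = ρ (σ * z) := by
        rw [map_mul, map_mul, hz]
        exact congrArg Subtype.val hcen
      have h1 := congrArg (fun φ ↦ (Multiplicative.toAdd φ) P) hc'
      simp only [hρ, galoisRepTorsion_apply, mul_smul] at h1
      exact h1
    exact ⟨z, smul_eq_neg_of_not_exists_stableLine ⊤ hno z hcomm hz2 hz1⟩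

/-- **`E[5]` irreducible ⟹ `−1 ∈ ρ̄_{E,5}(Γ_ℚ)`**: some `z ∈ Γ_ℚ` acts as `−1` on `E[5]`, for EVERY elliptic curve over
`ℚ` with irreducible mod-`5` representation (onto: `exists_smul_eq_neg_of_hasSurjectiveModNGaloisRep`; not onto: the
previous theorem). This is the `hneg` input of the (T4′) corner Čebotarev ∕ swap supply at `p = 5`.
[cite: Serre1972, §2.4 Prop. 15 and §2.6] [cite: SilvermanCSS1997, Ch. II §7 Proposition] -/
theorem exists_smul_eq_neg_five_of_irr (hirr : Irr W 5) :
    ∃ z : absoluteGaloisGroup ℚ, ∀ P : geomTorsion W ((5 : ℕ) : ℤ), z • P = -P := by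
  haveI : Fact (Nat.Prime 5) := ⟨by norm_num⟩
  by_cases hs : Surj W 5
  · exact exists_smul_eq_neg_of_hasSurjectiveModNGaloisRep W _ hs
  · exact exists_smul_eq_neg_five_of_irr_of_not_surj W hirr hs

end Five

end Summit.BirchSwinnertonDyer.Rank1Residual.GaloisImage

end
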